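import Literature.NumberTheory.Automorphic.ArchUnitaryRootVectors           -- ★ A1 p844391 (this seat): root vectors, torus-point jets
import Literature.NumberTheory.Automorphic.ArchUnitaryCasimirRootPairs        -- ★ B p844468 (this seat): Casimir vs swap∕twin double sum, pair by pair
import Mathlib.Analysis.Matrix.Normed
import HarnessLib

/-!
# Root-pair jets at a torus point read off the Casimir — pointwise bookkeeping (any `N`), the twisted form and its `Ad`-invariance, and the `N = 3` pattern `(c, nc, nc)`
# (Varadarajan 1989 §6.3; Hall GTM 222 Prop. 3.24) — ★ Z3a §4 `boost_jets_sum_eq_radial` for a block of any `GL_N`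

Topic `NumberTheory/Automorphic`; namespace `Literature.NumberTheory.Automorphic.RootVectors`.  THEOREMS ONLY (no `def`, no instance, no notation, no axiom, no named fact, no `sorry`).
Cell `pub/hodgecm-mathlib`, ENGINE T1 (crux H413 = `stmt-HodgeConjecture-24833`); ROAD A owner word 2026-09-01T12:22:33Z (o2′) «RANK-2 CASIMIR RADIAL EQUATION» (census bac477e2), FILE D1.
Author A-p18 (g26), 2026-09-01.

WHAT IS PROVED (`k ≠ l`, `pq = 1`, `P = E_kk + E_ll`, `H_kl = iE_kk − iE_ll`, root vectors `X̂, Ŷ` (noncompact) and `X, Y` (compact) of ★ A1; `γ = diag ζ` with `ζ_l = (C − Si)ζ_k`, `ζ_k = (C + Si)ζ_l`,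
`C² + S² = 1`; `B` real-bilinear continuous, `ℓ` real-linear continuous; `T, T′` arbitrary):
* §1 projector algebra: `P² = P`, `PX = XP = X` for the four root vectors, `Pᴴ = P`, `P·diag = diag·P`, `ŶγŶ = X̂γX̂`, `YγY = XγX`, the `Ŷ`∕`Y` second jets, `T(rA + sB)T′ = r•TAT′ + s•TBT′`.
* §2 `boostPair_jets_eq`: `Σ_{Z ∈ {X̂,Ŷ}} [B(T(Zγ − γZ)T′)² + ℓ(T((Pγ + γP) − 2ZγZ)T′)] = (2 − 2C)•Σ_Z [B(T(γZ)T′)² + ℓ(T(γZZ)T′)] + (4S)•ℓ(T(γH_kl)T′)`;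
  `rotationPair_jets_eq`: the same for `{X, Y}` with `−(Pγ + γP) − 2ZγZ` and `−(4S)`.
* §3 `exists_twistedForm` (`Φ(A,C) = B(T(M₀A)T′, T(M₀C)T′) + ℓ(T(M₀AC)T′)` is real-bilinear) and `twisted_swap_sub_twin_eq`: for `TT′ = 1 = T′T`, `T′ᴴ·diag e·T′ = diag e` (`e` real, nowhere zero)
  the swap∕twin double sum of `(A,C) ↦ B(YA,YC) + ℓ(YAC)`, `Y = TM₀T′`, equals that of `Φ` (★ A-p14).
* §4 `twoCasimir_three_eq` (`N = 3`, pair `(0,1)` compact, pairs `(0,2), (1,2)` noncompact): the swap∕twin double sum of any real-bilinear `Φ` is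
  `−2Σ_k Φ(iE_kk)² − [Φ(X₀₁)² + Φ(Y₀₁)²] + [Φ(X̂₀₂)² + Φ(Ŷ₀₂)²] + [Φ(X̂₁₂)² + Φ(Ŷ₁₂)²]` (★ B).
HONEST LABEL: finite-dimensional bookkeeping; pays nothing by itself (HC_CM is proved only modulo the printed citations until rung 0 closes).

## References
* [Varadarajan1989] V. S. Varadarajan, *An Introduction to Harmonic Analysis on Semisimple Lie Groups* (1989), §6.3.
* [Hall2015] B. C. Hall, *Lie Groups, Lie Algebras, and Representations*, 2nd ed., GTM 222 (2015), §3.6, Prop. 3.24.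
-/

set_option autoImplicit false

namespace Literature.NumberTheory.Automorphic.RootVectors

open Complex Matrix
open scoped ComplexConjugate

variable {N : ℕ}

/-! ## §1 Projector algebra of a root pair -/

section Projector

variable (k l : Fin N) (hkl : k ≠ l)
include hkl

/-- `P² = P`, `P = E_kk + E_ll`. [cite: Hall2015, §3.6] -/
theorem P_mul_P : (Matrix.single k k (1 : ℂ) + Matrix.single l l (1 : ℂ)) * (Matrix.single k k (1 : ℂ) + Matrix.single l l (1 : ℂ)) = (Matrix.single k k (1 : ℂ) + Matrix.single l l (1 : ℂ)) := by
  simp only [add_mul, mul_add, Matrix.single_mul_single_same, Matrix.single_mul_single_of_ne, hkl, hkl.symm, ne_eq, not_false_eq_true, add_zero, zero_add, mul_one]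

/-- `PX̂ = X̂ = X̂P`. [cite: Hall2015, §3.6] -/
theorem P_mul_Xh (p q : ℝ) : (Matrix.single k k (1 : ℂ) + Matrix.single l l (1 : ℂ)) * ((p : ℂ) • Matrix.single k l (1 : ℂ) + (q : ℂ) • Matrix.single l k (1 : ℂ)) = ((p : ℂ) • Matrix.single k l (1 : ℂ) + (q : ℂ) • Matrix.single l k (1 : ℂ)) ∧ ((p : ℂ) • Matrix.single k l (1 : ℂ) + (q : ℂ) • Matrix.single l k (1 : ℂ)) * (Matrix.single k k (1 : ℂ) + Matrix.single l l (1 : ℂ)) = ((p : ℂ) • Matrix.single k l (1 : ℂ) + (q : ℂ) • Matrix.single l k (1 : ℂ)) :=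
  ⟨by simp only [add_mul, mul_add, Matrix.mul_smul, Matrix.single_mul_single_same, Matrix.single_mul_single_of_ne, hkl, hkl.symm, ne_eq, not_false_eq_true, smul_zero, add_zero, zero_add, mul_one], by simp only [add_mul, mul_add, Matrix.smul_mul, Matrix.single_mul_single_same, Matrix.single_mul_single_of_ne, hkl, hkl.symm, ne_eq, not_false_eq_true, smul_zero, add_zero, zero_add, mul_one]; abel⟩

/-- `PŶ = Ŷ = ŶP`. [cite: Hall2015, §3.6] -/
theorem P_mul_Yh (p q : ℝ) : (Matrix.single k k (1 : ℂ) + Matrix.single l l (1 : ℂ)) * ((-((p : ℂ) * I)) • Matrix.single k l (1 : ℂ) + ((q : ℂ) * I) • Matrix.single l k (1 : ℂ)) = ((-((p : ℂ) * I)) • Matrix.single k l (1 : ℂ) + ((q : ℂ) * I) • Matrix.single l k (1 : ℂ)) ∧ ((-((p : ℂ) * I)) • Matrix.single k l (1 : ℂ) + ((q : ℂ) * I) • Matrix.single l k (1 : ℂ)) * (Matrix.single k k (1 : ℂ) + Matrix.single l l (1 : ℂ)) = ((-((p : ℂ) * I)) • Matrix.single k l (1 : ℂ) + ((q : ℂ)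 * I) • Matrix.single l k (1 : ℂ)) :=
  ⟨by simp only [add_mul, mul_add, Matrix.mul_smul, Matrix.single_mul_single_same, Matrix.single_mul_single_of_ne, hkl, hkl.symm, ne_eq, not_false_eq_true, smul_zero, add_zero, zero_add, mul_one], by simp only [add_mul, mul_add, Matrix.smul_mul, Matrix.single_mul_single_same, Matrix.single_mul_single_of_ne, hkl, hkl.symm, ne_eq, not_false_eq_true, smul_zero, add_zero, zero_add, mul_one]; abel⟩

/-- `PX = X = XP`. [cite: Hall2015, §3.6] -/
theorem P_mul_Xc (p q : ℝ) : (Matrix.single k k (1 : ℂ) + Matrix.single l l (1 : ℂ)) * ((p : ℂ) • Matrix.single k l (1 : ℂ) - (q : ℂ) • Matrix.single l k (1 : ℂ)) = ((p : ℂ) • Matrix.single k l (1 : ℂ) - (q : ℂ) • Matrix.single l k (1 : ℂ)) ∧ ((p : ℂ) • Matrix.single k l (1 : ℂ) - (q : ℂ) • Matrix.single l k (1 : ℂ)) * (Matrix.single k k (1 : ℂ) + Matrix.single l l (1 : ℂ)) = ((p : ℂ) • Matrix.single k l (1 : ℂ) - (q : ℂ) • Matrix.single l k (1 : ℂ)) 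:=
  ⟨by simp only [add_mul, mul_sub, Matrix.mul_smul, Matrix.single_mul_single_same, Matrix.single_mul_single_of_ne, hkl, hkl.symm, ne_eq, not_false_eq_true, smul_zero, add_zero, zero_add, mul_one], by simp only [mul_add, sub_mul, Matrix.smul_mul, Matrix.single_mul_single_same, Matrix.single_mul_single_of_ne, hkl, hkl.symm, ne_eq, not_false_eq_true, smul_zero, sub_zero, zero_sub, mul_one]; abel⟩

/-- `PY = Y = YP`. [cite: Hall2015, §3.6] -/
theorem P_mul_Yc (p q : ℝ) : (Matrix.single k k (1 : ℂ) + Matrix.single l l (1 : ℂ)) * (((p : ℂ) * I) • Matrix.single k l (1 : ℂ) + ((q : ℂ) * I) • Matrix.single l k (1 : ℂ)) = (((p : ℂ) * I) • Matrix.single k l (1 : ℂ) + ((q : ℂ) * I) • Matrix.single l k (1 : ℂ)) ∧ (((p : ℂ) * I) • Matrix.single k l (1 : ℂ) + ((q : ℂ) * I) • Matrix.single l k (1 : ℂ)) * (Matrix.single k k (1 : ℂ) + Matrix.single l l (1 : ℂ)) = (((p : ℂ) * I) • Matrix.single k l (1 : ℂ) + ((q : ℂ) * I) • Matrix.single l k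 (1 : ℂ)) :=
  ⟨by simp only [add_mul, mul_add, Matrix.mul_smul, Matrix.single_mul_single_same, Matrix.single_mul_single_of_ne, hkl, hkl.symm, ne_eq, not_false_eq_true, smul_zero, add_zero, zero_add, mul_one], by simp only [add_mul, mul_add, Matrix.smul_mul, Matrix.single_mul_single_same, Matrix.single_mul_single_of_ne, hkl, hkl.symm, ne_eq, not_false_eq_true, smul_zero, add_zero, zero_add, mul_one]; abel⟩

omit hkl in
/-- `Pᴴ = P` and `P` commutes with diagonals. [cite: Hall2015, §3.6] -/
theorem star_P_and_comm (d : Fin N → ℂ) : star (Matrix.single k k (1 : ℂ) + Matrix.single l l (1 : ℂ)) = (Matrix.single k k (1 : ℂ) + Matrix.single l l (1 : ℂ)) ∧ (Matrix.single k k (1 : ℂ) + Matrix.single l l (1 : ℂ)) * Matrix.diagonal d = Matrix.diagonal d * (Matrix.single k k (1 : ℂ) + Matrix.single l l (1 : ℂ)) := by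
  refine ⟨?_, ?_⟩
  · rw [star_add, ← one_smul ℂ (Matrix.single k k (1 : ℂ)), ← one_smul ℂ (Matrix.single l l (1 : ℂ)), star_smul_single, star_smul_single, map_one]
  · rw [add_mul, mul_add, single_mul_diagonal, single_mul_diagonal, diagonal_mul_single, diagonal_mul_single]

/-- `ŶγŶ = X̂γX̂` (`γ` diagonal). [cite: Varadarajan1989, §6.3] -/
theorem Yh_mul_diagonal_mul_Yh (p q : ℝ) (ζ : Fin N → ℂ) : ((-((p : ℂ) * I)) • Matrix.single k l (1 : ℂ) + ((q : ℂ) * I) • Matrix.single l k (1 : ℂ)) * Matrix.diagonal ζ * ((-((p : ℂ) * I)) • Matrix.single k l (1 : ℂ) + ((q : ℂ) * I) • Matrix.single l k (1 : ℂ)) = ((p : ℂ) • Matrix.single k l (1 : ℂ) + (q : ℂ) • Matrix.single l k (1 : ℂ)) * Matrix.diagonal ζ * ((p : ℂ) • Matrix.single k l (1 : ℂ) + (q : ℂ) • Matrix.single l k (1 : ℂ)) := by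
  simp only [add_mul, mul_add, Matrix.smul_mul, Matrix.mul_smul, smul_smul, single_mul_diagonal, Matrix.single_mul_single_same, Matrix.single_mul_single_of_ne, hkl, hkl.symm,
    ne_eq, not_false_eq_true, smul_zero, add_zero, zero_add, mul_one]
  linear_combination (norm := module) (-((p : ℂ) * ζ l * q) • I_sq) • Matrix.single k k (1 : ℂ) + (-((q : ℂ) * ζ k * p) • I_sq) • Matrix.single l l (1 : ℂ)

/-- `YγY = XγX` (`γ` diagonal). [cite: Varadarajan1989, §6.3] -/
theorem Yc_mul_diagonal_mul_Yc (p q : ℝ) (ζ : Fin N → ℂ) : (((p : ℂ) * I) • Matrix.single k l (1 : ℂ) + ((q : ℂ) * I) • Matrix.single l k (1 : ℂ)) * Matrix.diagonal ζ * (((p : ℂ) * I) • Matrix.single k l (1 : ℂ) + ((q : ℂ) * I) • Matrix.single l k (1 : ℂ)) = ((p : ℂ) • Matrix.single k l (1 : ℂ) - (q : ℂ) • Matrix.single l k (1 : ℂ)) * Matrix.diagonal ζ * ((p : ℂ) • Matrix.single k l (1 : ℂ) - (q : ℂ) • Matrix.single l k (1 : ℂ)) := by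
  simp only [add_mul, mul_add, sub_mul, mul_sub, Matrix.smul_mul, Matrix.mul_smul, smul_smul, single_mul_diagonal, Matrix.single_mul_single_same, Matrix.single_mul_single_of_ne, hkl, hkl.symm,
    ne_eq, not_false_eq_true, smul_zero, add_zero, zero_add, sub_zero, zero_sub, mul_one]
  linear_combination (norm := module) (((p : ℂ) * ζ l * q) • I_sq) • Matrix.single k k (1 : ℂ) + (((q : ℂ) * ζ k * p) • I_sq) • Matrix.single l l (1 : ℂ)

omit hkl in
/-- Conjugation distributes over REAL linear combinations: `T(rA + sB)T′ = r•TAT′ + s•TBT′`. [cite: Hall2015, §3.6] -/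
theorem conj_add_smul' (T T' A B : Matrix (Fin N) (Fin N) ℂ) (r s : ℝ) : T * (r • A + s • B) * T' = r • (T * A * T') + s • (T * B * T') := by
  rw [Matrix.mul_add, Matrix.add_mul, Matrix.mul_smul, Matrix.mul_smul, Matrix.smul_mul, Matrix.smul_mul]

end Projector

/-! ## §2 The jets of a root pair at a torus point, against `(B, ℓ)` -/

section Pair

variable {E : Type*} [NormedAddCommGroup E] [NormedSpace ℝ E]
variable (B : Matrix (Fin N) (Fin N) ℂ →L[ℝ] Matrix (Fin N) (Fin N) ℂ →L[ℝ] E) (ℓ : Matrix (Fin N) (Fin N) ℂ →L[ℝ] E) (k l : Fin N) (hkl : k ≠ l) {p q : ℝ} (hpq : p * q = 1)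
  (ζ : Fin N → ℂ) {C S : ℝ} (hb : ζ l = ((C : ℂ) - (S : ℂ) * I) * ζ k) (ha : ζ k = ((C : ℂ) + (S : ℂ) * I) * ζ l) (hCS : C ^ 2 + S ^ 2 = 1) (T T' : Matrix (Fin N) (Fin N) ℂ)
include hkl hpq hb ha hCS

/-- **NONCOMPACT PAIR**: `Σ_{Z = X̂, Ŷ} [B(T(Zγ − γZ)T′)² + ℓ(T((Pγ + γP) − 2ZγZ)T′)] = (2 − 2C)•Σ_Z [B(T(γZ)T′)² + ℓ(T(γZZ)T′)] + (4S)•ℓ(T(γH_kl)T′)` (★ A1 torus jets + ★ Z1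
`sum_boost_jets_eq`, `X̂² = Ŷ² = P`). [cite: Varadarajan1989, §6.3] -/
theorem boostPair_jets_eq :
    (B (T * (((p : ℂ) • Matrix.single k l (1 : ℂ) + (q : ℂ) • Matrix.single l k (1 : ℂ)) * Matrix.diagonal ζ - Matrix.diagonal ζ * ((p : ℂ) • Matrix.single k l (1 : ℂ) + (q : ℂ) • Matrix.single l k (1 : ℂ))) * T') (T * (((p : ℂ) • Matrix.single k l (1 : ℂ) + (q : ℂ) • Matrix.single l k (1 : ℂ)) * Matrix.diagonal ζ - Matrix.diagonal ζ * ((p : ℂ) • Matrix.single k l (1 : ℂ) + (q : ℂ) • Matrix.single l k (1 : ℂ))) * T') +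
          ℓ (T * ((Matrix.single k k (1 : ℂ) + Matrix.single l l (1 : ℂ)) * Matrix.diagonal ζ + Matrix.diagonal ζ * (Matrix.single k k (1 : ℂ) + Matrix.single l l (1 : ℂ)) - (2 : ℂ) • (((p : ℂ) • Matrix.single k l (1 : ℂ) + (q : ℂ) • Matrix.single l k (1 : ℂ)) * Matrix.diagonal ζ * ((p : ℂ) • Matrix.single k l (1 : ℂ) + (q : ℂ) • Matrix.single l k (1 : ℂ)))) * T')) +
        (B (T * (((-((p : ℂ) * I)) • Matrix.single k l (1 : ℂ) + ((q : ℂ) * I) • Matrix.single l k (1 : ℂ)) * Matrix.diagonal ζ - Matrix.diagonal ζ * ((-((p : ℂ) * I)) • Matrix.single k l (1 : ℂ) + ((q : ℂ) * I) • Matrix.single l k (1 : ℂ))) * T') (T * (((-((p : ℂ) * I)) • Matrix.single k l (1 : ℂ) + ((q : ℂ) * I) • Matrix.single l k (1 : ℂ)) * Matrix.diagonal ζ - Matrix.diagonal ζ * ((-((p : ℂ) * I)) • Matrix.single k l (1 : ℂ) + ((q : ℂ) * I) • Matrix.single l k (1 : ℂ))) * T') +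
          ℓ (T * ((Matrix.single k k (1 : ℂ) + Matrix.single l l (1 : ℂ)) * Matrix.diagonal ζ + Matrix.diagonal ζ * (Matrix.single k k (1 : ℂ) + Matrix.single l l (1 : ℂ)) - (2 : ℂ) • (((-((p : ℂ) * I)) • Matrix.single k l (1 : ℂ) + ((q : ℂ) * I) • Matrix.single l k (1 : ℂ)) * Matrix.diagonal ζ * ((-((p : ℂ) * I)) • Matrix.single k l (1 : ℂ) + ((q : ℂ) * I) • Matrix.single l k (1 : ℂ)))) * T')) =
      (2 - 2 * C) • ((B (T * (Matrix.diagonal ζ * ((p : ℂ) • Matrix.single k l (1 : ℂ) + (q : ℂ) • Matrix.single l k (1 : ℂ))) * T') (T * (Matrix.diagonal ζ * ((p : ℂ) • Matrix.single k l (1 : ℂ) + (q : ℂ) • Matrix.single l k (1 : ℂ))) * T') + ℓ (T * (Matrix.diagonal ζ * ((p : ℂ) • Matrix.single k l (1 : ℂ) + (q : ℂ) • Matrix.single l k (1 : ℂ)) * ((p : ℂ) • Matrix.single k l (1 : ℂ) + (q : ℂ) • Matrix.single l k (1 : ℂ))) * T')) +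
          (B (T * (Matrix.diagonal ζ * ((-((p : ℂ) * I)) • Matrix.single k l (1 : ℂ) + ((q : ℂ) * I) • Matrix.single l k (1 : ℂ))) * T') (T * (Matrix.diagonal ζ * ((-((p : ℂ) * I)) • Matrix.single k l (1 : ℂ) + ((q : ℂ) * I) • Matrix.single l k (1 : ℂ))) * T') + ℓ (T * (Matrix.diagonal ζ * ((-((p : ℂ) * I)) • Matrix.single k l (1 : ℂ) + ((q : ℂ) * I) • Matrix.single l k (1 : ℂ)) * ((-((p : ℂ) * I)) • Matrix.single k l (1 : ℂ) + ((q : ℂ) * I) • Matrix.single l k (1 : ℂ))) * T'))) +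
        (4 * S) • ℓ (T * (Matrix.diagonal ζ * (I • Matrix.single k k (1 : ℂ) - I • Matrix.single l l (1 : ℂ))) * T') := by
  rw [Yh_mul_diagonal_mul_Yh k l hkl p q ζ, Xh_mul_diagonal_sub (i := k) (j := l) (ζ := ζ) (hb := hb) (ha := ha), Yh_mul_diagonal_sub (i := k) (j := l) (ζ := ζ) (hb := hb) (ha := ha),
    boostJet_two_eq (i := k) (j := l) (hij := hkl) (hpq := hpq) (ζ := ζ) (hb := hb) (ha := ha),
    Matrix.mul_assoc (Matrix.diagonal ζ) ((p : ℂ) • Matrix.single k l (1 : ℂ) + (q : ℂ) • Matrix.single l k (1 : ℂ)), Xh_mul_Xh k l hkl hpq, Matrix.mul_assoc (Matrix.diagonal ζ) ((-((p : ℂ) * I)) • Matrix.single k l (1 : ℂ) + ((q : ℂ) * I) • Matrix.single l k (1 : ℂ)), Yh_mul_Yh k l hkl hpq]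
  simp only [conj_add_smul', map_add, map_smul, _root_.add_apply, _root_.smul_apply]
  linear_combination (norm := module) hCS • (B (T * (Matrix.diagonal ζ * ((p : ℂ) • Matrix.single k l (1 : ℂ) + (q : ℂ) • Matrix.single l k (1 : ℂ))) * T') (T * (Matrix.diagonal ζ * ((p : ℂ) • Matrix.single k l (1 : ℂ) + (q : ℂ) • Matrix.single l k (1 : ℂ))) * T') + B (T * (Matrix.diagonal ζ * ((-((p : ℂ) * I)) • Matrix.single k l (1 : ℂ) + ((q : ℂ) * I) • Matrix.single l k (1 : ℂ))) * T') (T * (Matrix.diagonal ζ * ((-((p : ℂ) * I)) • Matrix.single k l (1 : ℂ) + ((q : ℂ) * I) • Matrix.single l k (1 : ℂ))) * T'))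

/-- **COMPACT PAIR**: `Σ_{Z = X, Y} [B(T(Zγ − γZ)T′)² + ℓ(T(−(Pγ + γP) − 2ZγZ)T′)] = (2 − 2C)•Σ_Z [B(T(γZ)T′)² + ℓ(T(γZZ)T′)] − (4S)•ℓ(T(γH_kl)T′)` (`X² = Y² = −P`). [cite: Varadarajan1989, §6.3] -/
theorem rotationPair_jets_eq :
    (B (T * (((p : ℂ) • Matrix.single k l (1 : ℂ) - (q : ℂ) • Matrix.single l k (1 : ℂ)) * Matrix.diagonal ζ - Matrix.diagonal ζ * ((p : ℂ) • Matrix.single k l (1 : ℂ) - (q : ℂ) • Matrix.single l k (1 : ℂ))) * T') (T * (((p : ℂ) • Matrix.single k l (1 : ℂ) - (q : ℂ) • Matrix.single l k (1 : ℂ)) * Matrix.diagonal ζ - Matrix.diagonal ζ * ((p : ℂ) • Matrix.single k l (1 : ℂ) - (q : ℂ) • Matrix.single l k (1 : ℂ))) * T') +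
          ℓ (T * (-((Matrix.single k k (1 : ℂ) + Matrix.single l l (1 : ℂ)) * Matrix.diagonal ζ + Matrix.diagonal ζ * (Matrix.single k k (1 : ℂ) + Matrix.single l l (1 : ℂ))) - (2 : ℂ) • (((p : ℂ) • Matrix.single k l (1 : ℂ) - (q : ℂ) • Matrix.single l k (1 : ℂ)) * Matrix.diagonal ζ * ((p : ℂ) • Matrix.single k l (1 : ℂ) - (q : ℂ) • Matrix.single l k (1 : ℂ)))) * T')) +
        (B (T * ((((p : ℂ) * I) • Matrix.single k l (1 : ℂ) + ((q : ℂ) * I) • Matrix.single l k (1 : ℂ)) * Matrix.diagonal ζ - Matrix.diagonal ζ * (((p : ℂ) * I) • Matrix.single k l (1 : ℂ) + ((q : ℂ) * I) • Matrix.single l k (1 : ℂ))) * T') (T * ((((p : ℂ) * I) • Matrix.single k l (1 : ℂ) + ((q : ℂ) * I) • Matrix.single l k (1 : ℂ)) * Matrix.diagonal ζ - Matrix.diagonal ζ * (((p : ℂ) * I) • Matrix.single k l (1 : ℂ) + ((q : ℂ) * I) • Matrix.single l k (1 : ℂ))) * T') +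
          ℓ (T * (-((Matrix.single k k (1 : ℂ) + Matrix.single l l (1 : ℂ)) * Matrix.diagonal ζ + Matrix.diagonal ζ * (Matrix.single k k (1 : ℂ) + Matrix.single l l (1 : ℂ))) - (2 : ℂ) • ((((p : ℂ) * I) • Matrix.single k l (1 : ℂ) + ((q : ℂ) * I) • Matrix.single l k (1 : ℂ)) * Matrix.diagonal ζ * (((p : ℂ) * I) • Matrix.single k l (1 : ℂ) + ((q : ℂ) * I) • Matrix.single l k (1 : ℂ)))) * T')) =
      (2 - 2 * C) • ((B (T * (Matrix.diagonal ζ * ((p : ℂ) • Matrix.single k l (1 : ℂ) - (q : ℂ) • Matrix.single l k (1 : ℂ))) * T') (T * (Matrix.diagonal ζ * ((p : ℂ) • Matrix.single k l (1 : ℂ) - (q : ℂ) • Matrix.single l k (1 : ℂ))) * T') + ℓ (T * (Matrix.diagonal ζ * ((p : ℂ) • Matrix.single k l (1 : ℂ) - (q : ℂ) • Matrix.single l k (1 : ℂ)) * ((p : ℂ) • Matrix.single k l (1 : ℂ) - (q : ℂ) • Matrix.single l k (1 : ℂ))) * T')) +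
          (B (T * (Matrix.diagonal ζ * (((p : ℂ) * I) • Matrix.single k l (1 : ℂ) + ((q : ℂ) * I) • Matrix.single l k (1 : ℂ))) * T') (T * (Matrix.diagonal ζ * (((p : ℂ) * I) • Matrix.single k l (1 : ℂ) + ((q : ℂ) * I) • Matrix.single l k (1 : ℂ))) * T') + ℓ (T * (Matrix.diagonal ζ * (((p : ℂ) * I) • Matrix.single k l (1 : ℂ) + ((q : ℂ) * I) • Matrix.single l k (1 : ℂ)) * (((p : ℂ) * I) • Matrix.single k l (1 : ℂ) + ((q : ℂ) * I) • Matrix.single l k (1 : ℂ))) * T'))) -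
        (4 * S) • ℓ (T * (Matrix.diagonal ζ * (I • Matrix.single k k (1 : ℂ) - I • Matrix.single l l (1 : ℂ))) * T') := by
  rw [Yc_mul_diagonal_mul_Yc k l hkl p q ζ, Xc_mul_diagonal_sub (i := k) (j := l) (ζ := ζ) (hb := hb) (ha := ha), Yc_mul_diagonal_sub (i := k) (j := l) (ζ := ζ) (hb := hb) (ha := ha),
    rotationJet_two_eq (i := k) (j := l) (hij := hkl) (hpq := hpq) (ζ := ζ) (hb := hb) (ha := ha),
    Matrix.mul_assoc (Matrix.diagonal ζ) ((p : ℂ) • Matrix.single k l (1 : ℂ) - (q : ℂ) • Matrix.single l k (1 : ℂ)), Xc_mul_Xc k l hkl hpq, Matrix.mul_assoc (Matrix.diagonal ζ) (((p : ℂ) * I) • Matrix.single k l (1 : ℂ) + ((q : ℂ) * I) • Matrix.single l k (1 : ℂ)), Yc_mul_Yc k l hkl hpq, neg_neg, Matrix.mul_neg]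
  simp only [conj_add_smul', Matrix.mul_neg, Matrix.neg_mul, map_neg, map_add, map_smul, _root_.add_apply, _root_.smul_apply]
  linear_combination (norm := module) hCS • (B (T * (Matrix.diagonal ζ * ((p : ℂ) • Matrix.single k l (1 : ℂ) - (q : ℂ) • Matrix.single l k (1 : ℂ))) * T') (T * (Matrix.diagonal ζ * ((p : ℂ) • Matrix.single k l (1 : ℂ) - (q : ℂ) • Matrix.single l k (1 : ℂ))) * T') + B (T * (Matrix.diagonal ζ * (((p : ℂ) * I) • Matrix.single k l (1 : ℂ) + ((q : ℂ) * I) • Matrix.single l k (1 : ℂ))) * T') (T * (Matrix.diagonal ζ * (((p : ℂ) * I) • Matrix.single k l (1 : ℂ) + ((q : ℂ) * I) • Matrix.single l k (1 : ℂ))) * T'))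

end Pair

/-! ## §3 The twisted form `Φ(A,C) = B(T(M₀A)T′, T(M₀C)T′) + ℓ(T(M₀AC)T′)` and its `Ad(U(diag e))`-invariance -/

section Twisted

variable {E : Type*} [NormedAddCommGroup E] [NormedSpace ℝ E]

/-- The twisted form is real-bilinear. [cite: Hall2015, §3.6] -/
theorem exists_twistedForm (B : Matrix (Fin N) (Fin N) ℂ →L[ℝ] Matrix (Fin N) (Fin N) ℂ →L[ℝ] E) (ℓ : Matrix (Fin N) (Fin N) ℂ →L[ℝ] E) (T T' M₀ : Matrix (Fin N) (Fin N) ℂ) :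
    ∃ Φ : Matrix (Fin N) (Fin N) ℂ →ₗ[ℝ] Matrix (Fin N) (Fin N) ℂ →ₗ[ℝ] E, ∀ A C, Φ A C = B (T * (M₀ * A) * T') (T * (M₀ * C) * T') + ℓ (T * (M₀ * A * C) * T') := by
  refine ⟨LinearMap.mk₂ ℝ (fun A C => B (T * (M₀ * A) * T') (T * (M₀ * C) * T') + ℓ (T * (M₀ * A * C) * T')) ?_ ?_ ?_ ?_, fun A C => rfl⟩
  · intro A₁ A₂ C
    simp only [Matrix.mul_add, Matrix.add_mul, map_add, _root_.add_apply]; abel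
  · intro r A C
    simp only [Matrix.mul_smul, Matrix.smul_mul, map_smul, _root_.smul_apply, smul_add]
  · intro A C₁ C₂
    simp only [Matrix.mul_add, Matrix.add_mul, map_add]; abel
  · intro r A C
    simp only [Matrix.mul_smul, Matrix.smul_mul, map_smul, smul_add]

/-- **`Ad(U(diag e))`-invariance of the Casimir against `(B, ℓ)`**: for `TT′ = 1 = T′T`, `T′ᴴ·diag e·T′ = diag e` (`e` real, nowhere zero), `Y = TM₀T′`, and `Φ` the twisted form,
the swap∕twin double sum of `(A,C) ↦ B(YA, YC) + ℓ(YAC)` equals that of `Φ` (★ A-p14 `sum_sum_conj_single_swap_eq`, `sum_sum_smul_conj_single_same_eq` at `(M, M′) = (T′, T)`).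
[cite: Hall2015, Prop. 3.24] -/
theorem twisted_swap_sub_twin_eq (B : Matrix (Fin N) (Fin N) ℂ →L[ℝ] Matrix (Fin N) (Fin N) ℂ →L[ℝ] E) (ℓ : Matrix (Fin N) (Fin N) ℂ →L[ℝ] E) {T T' M₀ : Matrix (Fin N) (Fin N) ℂ} (hTT' : T * T' = 1) (hT'T : T' * T = 1)
    {e : Fin N → ℂ} (he : ∀ k, e k ≠ 0) (hereal : ∀ k, conj (e k) = e k) (hT'H : T'ᴴ * Matrix.diagonal e * T' = Matrix.diagonal e)
    {Φ : Matrix (Fin N) (Fin N) ℂ →ₗ[ℝ] Matrix (Fin N) (Fin N) ℂ →ₗ[ℝ] E} (hΦ : ∀ A C, Φ A C = B (T * (M₀ * A) * T') (T * (M₀ * C) * T') + ℓ (T * (M₀ * A * C) * T')) :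
    (∑ k, ∑ l, ((B (T * M₀ * T' * Matrix.single k l 1) (T * M₀ * T' * Matrix.single l k 1) + ℓ (T * M₀ * T' * Matrix.single k l 1 * Matrix.single l k 1)) -
        (B (T * M₀ * T' * (I • Matrix.single k l (1 : ℂ))) (T * M₀ * T' * (I • Matrix.single l k (1 : ℂ))) + ℓ (T * M₀ * T' * (I • Matrix.single k l (1 : ℂ)) * (I • Matrix.single l k (1 : ℂ)))))) -
      ∑ k, ∑ l, (e l / e k).re • ((B (T * M₀ * T' * Matrix.single k l 1) (T * M₀ * T' * Matrix.single k l 1) + ℓ (T * M₀ * T' * Matrix.single k l 1 * Matrix.single k l 1)) +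
        (B (T * M₀ * T' * (I • Matrix.single k l (1 : ℂ))) (T * M₀ * T' * (I • Matrix.single k l (1 : ℂ))) + ℓ (T * M₀ * T' * (I • Matrix.single k l (1 : ℂ)) * (I • Matrix.single k l (1 : ℂ))))) =
    (∑ k, ∑ l, (Φ (Matrix.single k l 1) (Matrix.single l k 1) - Φ (I • Matrix.single k l (1 : ℂ)) (I • Matrix.single l k (1 : ℂ)))) -
      ∑ k, ∑ l, (e l / e k).re • (Φ (Matrix.single k l 1) (Matrix.single k l 1) + Φ (I • Matrix.single k l (1 : ℂ)) (I • Matrix.single k l (1 : ℂ))) := by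
  have h1 := _root_.Literature.LinearAlgebra.Matrix.sum_sum_conj_single_swap_eq Φ hT'T
  have h2 := _root_.Literature.LinearAlgebra.Matrix.sum_sum_smul_conj_single_same_eq Φ he hereal hT'H hT'T
  have hTT'' : ∀ X : Matrix (Fin N) (Fin N) ℂ, T * (T' * X) = X := fun X => by rw [← Matrix.mul_assoc, hTT', Matrix.one_mul]
  have hΦ' : ∀ A C : Matrix (Fin N) (Fin N) ℂ, Φ (T' * A * T) (T' * C * T) = B (T * M₀ * T' * A) (T * M₀ * T' * C) + ℓ (T * M₀ * T' * A * C) := fun A C => by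
    rw [hΦ]
    congr 2 <;> simp only [Matrix.mul_assoc, hTT', hTT'', Matrix.mul_one]
  have hΦ'' : ∀ A C : Matrix (Fin N) (Fin N) ℂ, Φ (I • (T' * A * T)) (I • (T' * C * T)) = B (T * M₀ * T' * (I • A)) (T * M₀ * T' * (I • C)) + ℓ (T * M₀ * T' * (I • A) * (I • C)) := fun A C => by
    rw [← Matrix.smul_mul, ← Matrix.mul_smul, ← Matrix.smul_mul, ← Matrix.mul_smul, hΦ']
  rw [← h1, ← h2]
  simp only [hΦ', hΦ'']

end Twisted

/-! ## §4 `N = 3`, pattern (compact `(0,1)`, noncompact `(0,2)`, `(1,2)`) = `U(2,1)` realised on `diag(+,+,−)` -/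

section Three

variable {E : Type*} [AddCommGroup E] [Module ℝ E]

/-- **Twice the Casimir of `𝔲(e₀,e₁,e₂)` (`e₀e₁ > 0 > e₀e₂, e₁e₂`), as the swap∕twin double sum, in the root basis**: for every real-bilinear `Φ` on `M₃(ℂ)`,
`Σ_{k,l}[Φ(E_kl,E_lk) − Φ(iE_kl,iE_lk)] − Σ_{k,l} re(e_l∕e_k)•[Φ(E_kl,E_kl) + Φ(iE_kl,iE_kl)] = −2Σ_k Φ(iE_kk,iE_kk) − [Φ(X₀₁)² + Φ(Y₀₁)²] + [Φ(X̂₀₂)² + Φ(Ŷ₀₂)²] + [Φ(X̂₁₂)² + Φ(Ŷ₁₂)²]`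
(★ B pair by pair). [cite: Hall2015, Prop. 3.24] -/
theorem twoCasimir_three_eq (Φ : Matrix (Fin 3) (Fin 3) ℂ →ₗ[ℝ] Matrix (Fin 3) (Fin 3) ℂ →ₗ[ℝ] E) {e : Fin 3 → ℂ} (he : ∀ k, e k ≠ 0)
    {p₁ q₁ p₂ q₂ p₃ q₃ : ℝ} (h₁ : p₁ * q₁ = 1) (h₂ : p₂ * q₂ = 1) (h₃ : p₃ * q₃ = 1)
    (he₁ : (q₁ : ℂ) ^ 2 * e 1 = e 0) (he₂ : (q₂ : ℂ) ^ 2 * e 2 = -e 0) (he₃ : (q₃ : ℂ) ^ 2 * e 2 = -e 1) :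
    (∑ k, ∑ l, (Φ (Matrix.single k l 1) (Matrix.single l k 1) - Φ (I • Matrix.single k l (1 : ℂ)) (I • Matrix.single l k (1 : ℂ)))) -
      ∑ k, ∑ l, (e l / e k).re • (Φ (Matrix.single k l 1) (Matrix.single k l 1) + Φ (I • Matrix.single k l (1 : ℂ)) (I • Matrix.single k l (1 : ℂ))) =
    -((2 : ℝ) • (Φ (I • Matrix.single 0 0 (1 : ℂ)) (I • Matrix.single 0 0 (1 : ℂ)) + Φ (I • Matrix.single 1 1 (1 : ℂ)) (I • Matrix.single 1 1 (1 : ℂ)) +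
        Φ (I • Matrix.single 2 2 (1 : ℂ)) (I • Matrix.single 2 2 (1 : ℂ)))) -
      (Φ ((p₁ : ℂ) • Matrix.single 0 1 (1 : ℂ) - (q₁ : ℂ) • Matrix.single 1 0 (1 : ℂ)) ((p₁ : ℂ) • Matrix.single 0 1 (1 : ℂ) - (q₁ : ℂ) • Matrix.single 1 0 (1 : ℂ)) +
        Φ (((p₁ : ℂ) * I) • Matrix.single 0 1 (1 : ℂ) + ((q₁ : ℂ) * I) • Matrix.single 1 0 (1 : ℂ)) (((p₁ : ℂ) * I) • Matrix.single 0 1 (1 : ℂ) + ((q₁ : ℂ) * I) • Matrix.single 1 0 (1 : ℂ))) +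
      (Φ ((p₂ : ℂ) • Matrix.single 0 2 (1 : ℂ) + (q₂ : ℂ) • Matrix.single 2 0 (1 : ℂ)) ((p₂ : ℂ) • Matrix.single 0 2 (1 : ℂ) + (q₂ : ℂ) • Matrix.single 2 0 (1 : ℂ)) +
        Φ ((-((p₂ : ℂ) * I)) • Matrix.single 0 2 (1 : ℂ) + ((q₂ : ℂ) * I) • Matrix.single 2 0 (1 : ℂ)) ((-((p₂ : ℂ) * I)) • Matrix.single 0 2 (1 : ℂ) + ((q₂ : ℂ) * I) • Matrix.single 2 0 (1 : ℂ))) +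
      (Φ ((p₃ : ℂ) • Matrix.single 1 2 (1 : ℂ) + (q₃ : ℂ) • Matrix.single 2 1 (1 : ℂ)) ((p₃ : ℂ) • Matrix.single 1 2 (1 : ℂ) + (q₃ : ℂ) • Matrix.single 2 1 (1 : ℂ)) +
        Φ ((-((p₃ : ℂ) * I)) • Matrix.single 1 2 (1 : ℂ) + ((q₃ : ℂ) * I) • Matrix.single 2 1 (1 : ℂ)) ((-((p₃ : ℂ) * I)) • Matrix.single 1 2 (1 : ℂ) + ((q₃ : ℂ) * I) • Matrix.single 2 1 (1 : ℂ))) := by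
  have g01 := swap_sub_twin_pair_eq_rotation Φ h₁ (he 1) he₁
  have g02 := swap_sub_twin_pair_eq_boost Φ h₂ (he 2) he₂
  have g12 := swap_sub_twin_pair_eq_boost Φ h₃ (he 2) he₃
  have g00 := swap_sub_twin_diag_eq Φ (he 0)
  have g11 := swap_sub_twin_diag_eq Φ (he 1)
  have g22 := swap_sub_twin_diag_eq Φ (he 2)
  simp only [Fin.sum_univ_three]
  linear_combination (norm := module) g00 + g11 + g22 - g01 - g02 - g12

end Three

end Literature.NumberTheory.Automorphic.RootVectors
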